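import Mathlib
import Literature.NumberTheory.Sieve.BatemanHornProofs
import Literature.NumberTheory.Sieve.BatemanHornLinearProofs
import Literature.NumberTheory.Sieve.LinearEquationsInPrimesProofs
import Literature.NumberTheory.Sieve.LinearEquationsInPrimesDimOne
import Literature.NumberTheory.Sieve.LinearEquationsInPrimesOneForm
import HarnessLib

/-!
# The `d = 1` dictionary between Bateman–Horn systems of linear polynomials and Green–Tao systems
(solo-blind programme, session 12; part 1 of 2 — part 2 is `SoloBlindLinearBH`)

To a tuple `f = (fᵢ)ᵢ` of integer polynomials of degree `≤ 1`, `fᵢ = aᵢ X + bᵢ`, we attach the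
system `linSys f = (n ↦ aᵢ n + bᵢ)ᵢ` of affine-linear forms on `ℤ¹`
(`Literature.NumberTheory.Sieve.AffLinForm 1`) and prove the four entries of the dictionary used in
`SoloBlindLinearBH` to derive the linear case of the Bateman–Horn conjecture from the generalised
Hardy–Littlewood conjecture:

1. `isNondegenerateSystem_linSys` — for a Bateman–Horn system (`IsBatemanHornSystem f`) of
   degree-one polynomials, `linSys f` is non-degenerate in the Green–Tao sense (no constant form,
   no two forms rationally proportional: pairwise non-association of the irreducible `fᵢ`);
2. `localFactor_linSys` — at every prime the Green–Tao local factor is the Bateman–Horn factor,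
   `β_p(linSys f) = (1 - 1/p)^{-k} (1 - ρ_f(p)/p)` (via `goodCount_add_polyRootCountMod`:
   good residues and roots are complementary), hence `singularProduct (linSys f) = batemanHornConst f`,
   a positive convergent product (`singularProduct_linSys`, using the tree's
   `IsBatemanHornSystem.hasBatemanHornConst_holds`);
3. `primePointCount_linSys` — with the convex body `boxSet N = [0, N] ⊆ [-N, N]` the Green–Tao
   prime-point count at scale `N` is the Bateman–Horn count `polyPrimeCount f N`;
4. `archFactor_linSys_le`, `le_archFactor_linSys` — the archimedean factor of `(linSys f, [0,N])`
   lies in `[N - ∑ |bᵢ|, N]`;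
and the size bound `affLinSize_linSys_le` (`‖linSys f‖_N ≤ ∑ |aᵢ| + ∑ |bᵢ|` for `N ≥ 1`).

All inputs are theorems of the tree (Mathlib + the Literature library); no `sorry`, no new axioms.
-/

noncomputable section

open Filter Finset Polynomial Asymptotics MeasureTheory
open scoped Topology

namespace Summit.Parity.BatemanHorn.Theorems.SoloBlindLinearBHDictionary

open Literature.NumberTheory.Sieve

variable {k : ℕ}

/-! ### Linear polynomials and the attached system of affine-linear forms on `ℤ¹` -/

/-- The system of affine-linear forms `n ↦ (coeff 1 of fᵢ) · n + fᵢ(0)` on `ℤ¹` attached to a tuple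
of integer polynomials (meaningful when every `fᵢ` has degree `≤ 1`). -/
def linSys (f : Fin k → ℤ[X]) : Fin k → AffLinForm 1 :=
  fun i => ⟨![(f i).coeff 1], (f i).coeff 0⟩

/-- The linear coefficient of the `i`-th form of `linSys f` is `coeff 1` of `fᵢ`. -/
@[simp] theorem linSys_coeff (f : Fin k → ℤ[X]) (i : Fin k) :
    (linSys f i).coeff 0 = (f i).coeff 1 := rfl

/-- The constant of the `i`-th form of `linSys f` is `coeff 0` of `fᵢ`. -/
@[simp] theorem linSys_const (f : Fin k → ℤ[X]) (i : Fin k) :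
    (linSys f i).const = (f i).coeff 0 := rfl

/-- The coefficient vector of the `i`-th form of `linSys f`. -/
theorem linSys_coeff_fun (f : Fin k → ℤ[X]) (i : Fin k) :
    (linSys f i).coeff = ![(f i).coeff 1] := rfl

/-- A polynomial of degree `≤ 1` is evaluated by its two low coefficients. -/
theorem eval_of_natDegree_le_one {g : ℤ[X]} (hg : g.natDegree ≤ 1) (m : ℤ) :
    g.eval m = g.coeff 1 * m + g.coeff 0 := by
  conv_lhs => rw [eq_X_add_C_of_natDegree_le_one hg]
  simp only [eval_add, eval_mul, eval_C, eval_X]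

/-- For polynomials of degree `≤ 1`, the `i`-th form of `linSys f` evaluates as `fᵢ`. -/
theorem linSys_eval (f : Fin k → ℤ[X]) (hdeg : ∀ i, (f i).natDegree ≤ 1) (i : Fin k)
    (n : Fin 1 → ℤ) : (linSys f i).eval n = (f i).eval (n 0) := by
  rw [DimOne.eval_eq, linSys_coeff, linSys_const, eval_of_natDegree_le_one (hdeg i)]

/-- Real evaluation of the forms of `linSys f`. -/
theorem linSys_realEval (f : Fin k → ℤ[X]) (i : Fin k) (x : Fin 1 → ℝ) :
    (linSys f i).realEval x = ((f i).coeff 1 : ℝ) * x 0 + ((f i).coeff 0 : ℝ) := by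
  rw [DimOne.realEval_eq, linSys_coeff, linSys_const]

/-- Evaluation of the forms of `linSys f` modulo `p`. -/
theorem linSys_modEval (f : Fin k → ℤ[X]) (i : Fin k) {p : ℕ} (v : Fin 1 → ZMod p) :
    (linSys f i).modEval p v = ((f i).coeff 1 : ZMod p) * v 0 + ((f i).coeff 0 : ZMod p) := by
  rw [OneForm.modEval_eq, linSys_coeff, linSys_const]

/-- In a Bateman–Horn system of linear polynomials the linear coefficients are positive. -/
theorem coeff_one_pos {f : Fin k → ℤ[X]} (hf : IsBatemanHornSystem f)
    (hdeg : ∀ i, (f i).natDegree = 1) (i : Fin k) : 0 < (f i).coeff 1 := by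
  have h := hf.leadingCoeff_pos i
  rwa [← coeff_natDegree, hdeg i] at h

/-! ### Non-degeneracy -/

/-- The system of forms attached to a Bateman–Horn system of linear polynomials is non-degenerate:
no form is constant, and no two are proportional (pairwise non-association of the irreducible
`fᵢ`). -/
theorem isNondegenerateSystem_linSys {f : Fin k → ℤ[X]} (hf : IsBatemanHornSystem f)
    (hdeg : ∀ i, (f i).natDegree = 1) : IsNondegenerateSystem (linSys f) := by
  have hdeg' : ∀ i, (f i).natDegree ≤ 1 := fun i => (hdeg i).le
  refine ⟨fun i h => ?_, fun i j hij a b hab => ?_⟩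
  · have h0 := congrFun h 0
    rw [linSys_coeff, Pi.zero_apply] at h0
    exact (coeff_one_pos hf hdeg i).ne' h0
  · have hpoly : C a * f i = C b * f j := by
      apply Polynomial.funext
      intro m
      have h := hab (fun _ => m)
      rw [linSys_eval f hdeg', linSys_eval f hdeg'] at h
      simpa only [eval_mul, eval_C] using h
    have hfi0 : f i ≠ 0 := (hf.irreducible i).ne_zero
    have hfj0 : f j ≠ 0 := (hf.irreducible j).ne_zero
    by_cases ha : a = 0
    · subst ha
      rw [C_0, zero_mul] at hpoly
      rcases mul_eq_zero.mp hpoly.symm with h | h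
      · exact ⟨rfl, C_eq_zero.mp h⟩
      · exact absurd h hfj0
    · exfalso
      by_cases hb : b = 0
      · subst hb
        rw [C_0, zero_mul] at hpoly
        rcases mul_eq_zero.mp hpoly with h | h
        · exact ha (C_eq_zero.mp h)
        · exact hfi0 h
      · have hdvd : f i ∣ C b * f j := ⟨C a, by rw [← hpoly, mul_comm]⟩
        have hprime : Prime (f i) :=
          UniqueFactorizationMonoid.irreducible_iff_prime.mp (hf.irreducible i)
        rcases hprime.dvd_or_dvd hdvd with h1 | h1
        · have hle := natDegree_le_of_dvd h1 (C_ne_zero.mpr hb)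
          rw [natDegree_C, hdeg i] at hle
          exact Nat.not_succ_le_zero 0 hle
        · exact hf.pairwise_not_associated hij
            ((hf.irreducible i).associated_of_dvd (hf.irreducible j) h1)

/-! ### Size of the system -/

/-- For `N ≥ 1` the Green–Tao size `‖linSys f‖_N` is at most `∑ |aᵢ| + ∑ |bᵢ|`. -/
theorem affLinSize_linSys_le (f : Fin k → ℤ[X]) {N : ℕ} (hN : 1 ≤ N) :
    affLinSize (linSys f) (N : ℝ) ≤ ∑ i, |((f i).coeff 1 : ℝ)| + ∑ i, |((f i).coeff 0 : ℝ)| := by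
  have hN1 : (1 : ℝ) ≤ N := by exact_mod_cast hN
  have hN0 : (0 : ℝ) < N := by linarith
  unfold affLinSize
  simp only [Fin.sum_univ_one, linSys_coeff, linSys_const]
  refine add_le_add le_rfl (Finset.sum_le_sum fun i _ => ?_)
  rw [abs_div, abs_of_pos hN0]
  exact div_le_self (abs_nonneg _) hN1

/-! ### Local factors: the singular product is the Bateman–Horn constant -/

/-- At a prime `p`, the number of good residues of `linSys f` and the Bateman–Horn root count
`ρ_f(p)` are complementary: `goodCount + ρ_f(p) = p`. -/
theorem goodCount_add_polyRootCountMod {f : Fin k → ℤ[X]} (hdeg : ∀ i, (f i).natDegree ≤ 1)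
    {p : ℕ} [hp : Fact p.Prime] : goodCount (linSys f) p + polyRootCountMod f p = p := by
  classical
  set P : ZMod p → Prop :=
    fun x => ∃ i, ((f i).coeff 1 : ZMod p) * x + ((f i).coeff 0 : ZMod p) = 0 with hP
  have hgood : goodCount (linSys f) p = #{x : ZMod p | ¬ P x} := by
    unfold goodCount
    rw [← OneForm.card_filter_fin_one (fun x => ¬ P x)]
    congr 1
    ext v
    simp only [Finset.mem_filter, Finset.mem_univ, true_and, linSys_modEval, hP, not_exists]
  have hroot : polyRootCountMod f p = #{x : ZMod p | P x} := by
    unfold polyRootCountMod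
    refine Finset.card_nbij' (fun n : ℕ ↦ (n : ZMod p)) (fun x : ZMod p ↦ x.val) ?_ ?_ ?_ ?_
    · intro n hn
      rw [mem_coe, mem_filter, mem_range] at hn
      simp only [mem_coe, mem_filter, mem_univ, true_and, hP]
      obtain ⟨i, -, hi⟩ := (natCast_dvd_prod_int_iff hp.out _ _).mp hn.2
      refine ⟨i, ?_⟩
      rw [← ZMod.intCast_zmod_eq_zero_iff_dvd, eval_of_natDegree_le_one (hdeg i)] at hi
      push_cast at hi
      exact hi
    · intro x hx
      simp only [mem_coe, mem_filter, mem_univ, true_and, hP] at hx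
      rw [mem_coe, mem_filter, mem_range]
      refine ⟨ZMod.val_lt x, ?_⟩
      obtain ⟨i, hi⟩ := hx
      refine (natCast_dvd_prod_int_iff hp.out _ _).mpr ⟨i, mem_univ _, ?_⟩
      rw [← ZMod.intCast_zmod_eq_zero_iff_dvd, eval_of_natDegree_le_one (hdeg i)]
      push_cast
      rw [ZMod.natCast_zmod_val]
      exact hi
    · intro n hn
      rw [mem_coe, mem_filter, mem_range] at hn
      exact ZMod.val_natCast_of_lt hn.1
    · intro x _
      exact ZMod.natCast_zmod_val x
  rw [hgood, hroot, add_comm, Finset.card_filter_add_card_filter_not, Finset.card_univ, ZMod.card]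

/-- **Local dictionary.** At every prime the Green–Tao local factor of `linSys f` is the
Bateman–Horn factor `(1 - 1/p)^{-k} (1 - ρ_f(p)/p)`. -/
theorem localFactor_linSys {f : Fin k → ℤ[X]} (hdeg : ∀ i, (f i).natDegree ≤ 1) {p : ℕ}
    (hp : p.Prime) :
    localFactor (linSys f) p =
      (1 - 1 / (p : ℝ))⁻¹ ^ k * (1 - (polyRootCountMod f p : ℝ) / p) := by
  haveI := Fact.mk hp
  have hsum := goodCount_add_polyRootCountMod hdeg (p := p)
  have hgc : (goodCount (linSys f) p : ℝ) = p - polyRootCountMod f p := by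
    have h : ((goodCount (linSys f) p + polyRootCountMod f p : ℕ) : ℝ) = p := by
      exact_mod_cast hsum
    push_cast at h
    linarith
  rw [localFactor_prime, pow_one, hgc]
  have hp1 : (1 : ℝ) < p := by exact_mod_cast hp.one_lt
  have hp0 : (p : ℝ) ≠ 0 := by positivity
  have hpm : (p : ℝ) - 1 ≠ 0 := by linarith
  have hinv : (1 - 1 / (p : ℝ))⁻¹ = p / (p - 1) := by
    rw [one_sub_div hp0, inv_div]
  rw [hinv]
  field_simp

/-- The partial singular products of `linSys f` are the partial Bateman–Horn products. -/
theorem singularProductPartial_linSys {f : Fin k → ℤ[X]} (hdeg : ∀ i, (f i).natDegree ≤ 1)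
    (x : ℕ) : singularProductPartial (linSys f) x = batemanHornPartial f x := by
  unfold singularProductPartial batemanHornPartial
  refine Finset.prod_congr rfl fun p hp => ?_
  rw [localFactor_linSys hdeg (Nat.mem_primesLE.mp hp).2, Fintype.card_fin]

/-- **The singular product is the Bateman–Horn constant**, which is positive and is the limit of
the partial products. -/
theorem singularProduct_linSys {f : Fin k → ℤ[X]} (hf : IsBatemanHornSystem f)
    (hdeg : ∀ i, (f i).natDegree ≤ 1) :
    singularProduct (linSys f) = batemanHornConst f ∧ 0 < batemanHornConst f ∧
      HasBatemanHornConst f (batemanHornConst f) := by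
  obtain ⟨hC, hpos⟩ := IsBatemanHornSystem.hasBatemanHornConst_holds hf
  refine ⟨?_, hpos, hC⟩
  have h : Tendsto (singularProductPartial (linSys f)) atTop (𝓝 (batemanHornConst f)) := by
    have h' : Tendsto (batemanHornPartial f) atTop (𝓝 (batemanHornConst f)) := hC
    exact h'.congr fun x => (singularProductPartial_linSys hdeg x).symm
  exact h.limUnder_eq

/-! ### The convex body `[0, N]` and the prime-point count -/

/-- The convex body `K_N = [0, N] ⊆ ℝ¹`. -/
def boxSet (N : ℕ) : Set (Fin 1 → ℝ) := Set.Icc (fun _ => (0 : ℝ)) (fun _ => (N : ℝ))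

/-- `[0, N]` is convex. -/
theorem boxSet_convex (N : ℕ) : Convex ℝ (boxSet N) := convex_Icc _ _

/-- `[0, N] ⊆ [-N, N]`. -/
theorem boxSet_subset (N : ℕ) : boxSet N ⊆ realBox 1 (N : ℝ) := by
  intro x hx
  rw [boxSet, Set.mem_Icc, Pi.le_def, Pi.le_def] at hx
  rw [realBox, Set.mem_Icc, Pi.le_def, Pi.le_def]
  have hN : (0 : ℝ) ≤ N := Nat.cast_nonneg N
  exact ⟨fun j => by linarith [hx.1 j], hx.2⟩

/-- Membership of a constant vector in `[0, N]`. -/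
theorem mem_boxSet_const {N : ℕ} {r : ℝ} :
    (fun _ : Fin 1 => r) ∈ boxSet N ↔ 0 ≤ r ∧ r ≤ N := by
  rw [boxSet, Set.mem_Icc, Pi.le_def, Pi.le_def, Fin.forall_fin_one, Fin.forall_fin_one]

/-- Membership of an integer constant vector in `[0, N]`. -/
theorem mem_boxSet_intCast {N : ℕ} {m : ℤ} :
    (fun _ : Fin 1 => (m : ℝ)) ∈ boxSet N ↔ 0 ≤ m ∧ m ≤ N := by
  rw [mem_boxSet_const]
  constructor
  · rintro ⟨h1, h2⟩
    exact ⟨by exact_mod_cast h1, by exact_mod_cast h2⟩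
  · rintro ⟨h1, h2⟩
    exact ⟨by exact_mod_cast h1, by exact_mod_cast h2⟩

/-- **Counting dictionary.** With `K_N = [0, N]` the Green–Tao prime-point count of `linSys f` at
scale `N` is the Bateman–Horn count `π_f(N)`. -/
theorem primePointCount_linSys {f : Fin k → ℤ[X]} (hdeg : ∀ i, (f i).natDegree ≤ 1) (N : ℕ) :
    primePointCount (linSys f) (boxSet N) N = polyPrimeCount f N := by
  classical
  unfold primePointCount polyPrimeCount
  rw [DimOne.card_filter_latticeBox]
  simp only [DimOne.realPoint_const, linSys_eval f hdeg, mem_boxSet_intCast]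
  refine Finset.card_nbij' (fun m : ℤ => m.toNat) (fun n : ℕ => (n : ℤ)) ?_ ?_ ?_ ?_
  · intro m hm
    simp only [mem_coe, mem_filter, mem_Icc] at hm
    obtain ⟨-, ⟨hm0, hmN⟩, hpr⟩ := hm
    simp only [mem_coe, mem_filter, mem_range]
    have hcast : ((m.toNat : ℕ) : ℤ) = m := Int.toNat_of_nonneg hm0
    refine ⟨by omega, fun i => ⟨?_, by rw [hcast]; exact hpr i⟩⟩
    rw [hcast]
    have h2 := (hpr i).two_le
    by_contra hle
    push Not at hle
    rw [Int.toNat_eq_zero.mpr hle] at h2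
    omega
  · intro n hn
    simp only [mem_coe, mem_filter, mem_range] at hn
    obtain ⟨hn, hpr⟩ := hn
    simp only [mem_coe, mem_filter, mem_Icc]
    exact ⟨⟨by omega, by omega⟩, ⟨by omega, by omega⟩, fun i => (hpr i).2⟩
  · intro m hm
    simp only [mem_coe, mem_filter, mem_Icc] at hm
    exact Int.toNat_of_nonneg hm.2.1.1
  · intro n _
    exact Int.toNat_natCast n

/-! ### The archimedean factor is `N + O(1)` -/

/-- The positivity region inside `K_N`, as a subset of `ℝ`. -/
theorem posRegion_subset_Icc (f : Fin k → ℤ[X]) (N : ℕ) :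
    {r : ℝ | (fun _ : Fin 1 => r) ∈ boxSet N ∧ ∀ i, 0 < (linSys f i).realEval fun _ => r} ⊆
      Set.Icc (0 : ℝ) N := by
  intro r hr
  exact mem_boxSet_const.mp hr.1

/-- The archimedean factor of `(linSys f, [0, N])` is at most `N`. -/
theorem archFactor_linSys_le (f : Fin k → ℤ[X]) (N : ℕ) :
    archFactor (linSys f) (boxSet N) ≤ N := by
  rw [DimOne.archFactor_eq]
  have hfin : volume (Set.Icc (0 : ℝ) N) ≠ ⊤ := by
    rw [Real.volume_Icc]; exact ENNReal.ofReal_ne_top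
  calc (volume {r : ℝ | (fun _ : Fin 1 => r) ∈ boxSet N ∧
          ∀ i, 0 < (linSys f i).realEval fun _ => r}).toReal
        ≤ (volume (Set.Icc (0 : ℝ) N)).toReal :=
          ENNReal.toReal_mono hfin (measure_mono (posRegion_subset_Icc f N))
    _ = N := by
          rw [Real.volume_Icc, sub_zero, ENNReal.toReal_ofReal (Nat.cast_nonneg N)]

/-- The archimedean factor of `(linSys f, [0, N])` is at least `N - ∑ |bᵢ|` (every form is positive on
`(∑ |bᵢ|, N]` because the linear coefficients are `≥ 1`). -/
theorem le_archFactor_linSys {f : Fin k → ℤ[X]} (hf : IsBatemanHornSystem f)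
    (hdeg : ∀ i, (f i).natDegree = 1) (N : ℕ) :
    (N : ℝ) - ∑ i, |((f i).coeff 0 : ℝ)| ≤ archFactor (linSys f) (boxSet N) := by
  set B : ℝ := ∑ i, |((f i).coeff 0 : ℝ)| with hBdef
  have hB : 0 ≤ B := Finset.sum_nonneg fun _ _ => abs_nonneg _
  rw [DimOne.archFactor_eq]
  set S : Set ℝ := {r : ℝ | (fun _ : Fin 1 => r) ∈ boxSet N ∧
    ∀ i, 0 < (linSys f i).realEval fun _ => r} with hSdef
  by_cases hBN : (N : ℝ) ≤ B
  · exact le_trans (by linarith) ENNReal.toReal_nonneg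
  push Not at hBN
  have hsub : Set.Ioc B (N : ℝ) ⊆ S := by
    intro r hr
    obtain ⟨hBr, hrN⟩ := hr
    refine ⟨mem_boxSet_const.mpr ⟨by linarith, hrN⟩, fun i => ?_⟩
    rw [linSys_realEval]
    have ha : (1 : ℝ) ≤ ((f i).coeff 1 : ℝ) := by exact_mod_cast coeff_one_pos hf hdeg i
    have hb : |((f i).coeff 0 : ℝ)| ≤ B :=
      Finset.single_le_sum (f := fun i => |((f i).coeff 0 : ℝ)|) (fun _ _ => abs_nonneg _)
        (Finset.mem_univ i)
    have hb' := neg_abs_le ((f i).coeff 0 : ℝ)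
    have hr0 : 0 < r := by linarith
    nlinarith
  have hfin : volume S ≠ ⊤ := by
    refine ne_top_of_le_ne_top (b := volume (Set.Icc (0 : ℝ) N)) ?_
      (measure_mono (posRegion_subset_Icc f N))
    rw [Real.volume_Icc]; exact ENNReal.ofReal_ne_top
  calc (N : ℝ) - B = (volume (Set.Ioc B (N : ℝ))).toReal := by
        rw [Real.volume_Ioc, ENNReal.toReal_ofReal (by linarith)]
    _ ≤ (volume S).toReal := ENNReal.toReal_mono hfin (measure_mono hsub)

end Summit.Parity.BatemanHorn.Theorems.SoloBlindLinearBHDictionary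

end
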